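import Mathlib
import Summits.NavierStokesRegularity.NavierStokesRegularity.Theses.RootDecompFactorLadder
import Summits.NavierStokesRegularity.NavierStokesRegularity.Theorems.RootDecompFactorLadderFakeBreather
import Summits.NavierStokesRegularity.NavierStokesRegularity.Theorems.QuantisedSymmetryPolyhedralDssProfileExistsStubAncientMildOfClassicalTypeI
import Literature.Analysis.FluidPDE.SelfSimilar
import Literature.Analysis.FluidPDE.ClassicalSolution
import Literature.Analysis.FluidPDE.PineauVicolRSS
import Literature.Analysis.FluidPDE.PineauVicolRSSHolds
import Literature.Analysis.FluidPDE.PineauVicolRDSSLeray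

/-!
# N26's FOLD-OR-FLEE glue PROVED: `SpinStructure → UniformEnvelope → ClosedBadSpeeds → SpeedPersistence → AccumulatingFactorLiouville`

Route `RootDecompFactorLadder` (decomp-ns node N26), layer-2 MECHANISM split of the blocker A =
`AccumulatingFactorLiouville` (stmt-33311, the scaling-soliton / accumulating-factor sector of the Type-I DSS wall)
by the CONTINUITY METHOD on the angular-speed dial of rotated self-similar Type-I fields (lens-1 g15 «FOLD OR FLEE»,
critic row 174 CLEARED): Σ `SpinStructure` (closed-subgroup structure theorem: A's class is a.e. trivial or an
O(3)-conjugate of a nontrivial classical Type-I Pineau–Vicol RSS field), E `UniformEnvelope` (declared residual «no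
counterexample flees»), C `ClosedBadSpeeds` (expected theorem, first prover target: bad speeds closed at fixed
envelope), P `SpeedPersistence` (declared residual «no counterexample sits at a fold»). This file proves the generated
glue item (fold or flee: closed ∧ open ∧ confined ∧ the tree's corner α = 0 ⟹ empty, ℝ connected; then Σ changes
language), the EXACTNESS `A ↔ Σ ∧ E ∧ C ∧ P`, and the Chae–Wolf floor rungs deciding C and P below the smallness
floor. Sources: Pineau–Vicol 2026 (arXiv:2607.09619, Thm 1.4); Chae–Wolf (arXiv:1610.09464); KNSS 2009 (arXiv:0709.3599 §4);
Jia–Šverák 2014 (arXiv:1204.0529); Guillod–Šverák 2017 (arXiv:1704.00560).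
-/

namespace Summit.NavierStokesRegularity.NavierStokesRegularity.Theorems.RootDecompFactorLadderFoldOrFlee

open MeasureTheory Set Filter Function
open scoped Topology ContDiff
open Literature.Analysis Literature.Analysis.FluidPDE
open Summit.NavierStokesRegularity.NavierStokesRegularity.Theses

/-! ## §1 FOLD OR FLEE (abstract: any preconnected dial range) -/

/-- In a preconnected space a closed, open set missing a point is empty. -/
theorem eq_empty_of_isClosed_of_isOpen_of_not_mem {X : Type*} [TopologicalSpace X] [PreconnectedSpace X]
    {s : Set X} {a : X} (hc : IsClosed s) (ho : IsOpen s) (ha : a ∉ s) : s = ∅ := by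
  rcases isClopen_iff.mp ⟨hc, ho⟩ with h | h
  · exact h
  · rw [h] at ha
    exact absurd (mem_univ a) ha

/-- **FOLD OR FLEE.** An envelope-indexed family of bad dial values over a preconnected dial range is EMPTY at
every level as soon as: no counterexample FLEES (one level contains all), each level is CLOSED, no counterexample
sits at a FOLD (`Bad C ⊆ interior (Bad C')` for `C < C'`), and every level misses some dial value (a proved corner). -/
theorem fold_or_flee {X : Type*} [TopologicalSpace X] [PreconnectedSpace X] (Bad : ℝ → Set X)
    (hflee : ∃ Cs : ℝ, ∀ C, Bad C ⊆ Bad Cs) (hclosed : ∀ C, IsClosed (Bad C))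
    (hfold : ∀ C C' : ℝ, C < C' → Bad C ⊆ interior (Bad C')) (hcorner : ∀ C, ∃ a, a ∉ Bad C) :
    ∀ C, Bad C = ∅ := by
  obtain ⟨Cs, hCs⟩ := hflee
  have hsub : Bad Cs ⊆ interior (Bad Cs) :=
    (hfold Cs (Cs + 1) (by linarith)).trans (interior_mono (hCs (Cs + 1)))
  have hopen : IsOpen (Bad Cs) := subset_interior_iff_isOpen.mp hsub
  obtain ⟨a, ha⟩ := hcorner Cs
  have hempty : Bad Cs = ∅ := eq_empty_of_isClosed_of_isOpen_of_not_mem (hclosed Cs) hopen ha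
  intro C
  exact eq_empty_of_subset_empty (hempty ▸ hCs C)

/-! ## §2 The rotated self-similar Type-I class (Pineau–Vicol frame): profile regularity and the corner α = 0 -/

/-- At `t = −1` the ansatz field IS the profile. -/
theorem pvAnsatz_profile_neg_one (α : ℝ) (U : EuclideanSpace ℝ (Fin 3) → EuclideanSpace ℝ (Fin 3)) :
    pvAnsatz α (fun y _ => U y) (-1) = U :=
  funext fun x => by rw [pvAnsatz_neg_one]

/-- The profile of a classical RSS member is `C²`. -/
theorem rss_contDiff {α : ℝ} {U : EuclideanSpace ℝ (Fin 3) → EuclideanSpace ℝ (Fin 3)} {p : ℝ → EuclideanSpace ℝ (Fin 3) → ℝ}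
    (h : IsClassicalNSSolutionOn (Set.Iio 0) 1 0 (pvAnsatz α (fun y _ => U y)) p) : ContDiff ℝ 2 U := by
  have h1 : ContDiff ℝ ∞ (pvAnsatz α (fun y _ => U y) (-1)) := h.contDiff_velocity (Set.mem_Iio.mpr (by norm_num))
  rw [pvAnsatz_profile_neg_one] at h1
  exact h1.of_le (by norm_cast)

/-- A member with non-positive envelope is trivial. -/
theorem rss_eq_zero_of_nonpos {C α : ℝ} {U : EuclideanSpace ℝ (Fin 3) → EuclideanSpace ℝ (Fin 3)}
    (hI : HasTypeIDecay C (pvAnsatz α (fun y _ => U y))) (hC : C ≤ 0) : U = 0 := by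
  funext x
  have hx := hI (-1) (by norm_num) x
  have h0 : C / (‖x‖ + Real.sqrt (-(-1 : ℝ))) ≤ 0 := div_nonpos_iff.2 (Or.inr ⟨hC, by positivity⟩)
  have hz : pvAnsatz α (fun y _ => U y) (-1) x = 0 := norm_le_zero_iff.1 (hx.trans h0)
  rw [pvAnsatz_neg_one] at hz
  exact hz

/-- **THE CORNER, FROM THE TREE.** The speed `α = 0` is never bad: Pineau–Vicol 2026 Thm 1.4
(`pineauVicol2026_rss_liouville_holds`, small-|α| half) restricted to `[−1,0)`; at non-positive envelope every
member is trivial outright. -/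
theorem zero_not_mem_bad (C : ℝ) : (0 : ℝ) ∉ {α : ℝ | ∃ (U : EuclideanSpace ℝ (Fin 3) → EuclideanSpace ℝ (Fin 3)) (p : ℝ → EuclideanSpace ℝ (Fin 3) → ℝ), (Literature.Analysis.FluidPDE.IsClassicalNSSolutionOn (Set.Iio 0) 1 0 (Literature.Analysis.FluidPDE.pvAnsatz α (fun y _ => U y)) p ∧ Literature.Analysis.FluidPDE.HasTypeIDecay C (Literature.Analysis.FluidPDE.pvAnsatz α (fun y _ => U y))) ∧ U ≠ 0} := by
  rintro ⟨U, p, hm, hU⟩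
  rcases le_or_gt C 0 with hC | hC
  · exact hU (rss_eq_zero_of_nonpos hm.2 hC)
  · obtain ⟨a₁, a₂, ha₁, _, hPV⟩ := pineauVicol2026_rss_liouville_holds C hC
    exact hU (hPV 0 _ p U (hm.1.mono Set.Ico_subset_Iio_self (uniqueDiffOn_Ico (-1) 0))
      (fun t ht x => hm.2 t ht.2 x) (rss_contDiff hm.1) (fun _ _ _ => rfl) (Or.inl (by simpa using ha₁)))

/-! ## §3 THE GLUE: Σ ∧ E ∧ C ∧ P ⟹ A (fold or flee on the speed dial; ℝ is connected) -/

/-- **E ∧ C ∧ P ⟹ RSS Liouville at ALL speeds**: every classical Type-I rotated self-similar field is trivial. -/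
theorem rssLiouville_of_pieces (hE : Summit.NavierStokesRegularity.NavierStokesRegularity.Theses.RootDecompFactorLadder.UniformEnvelope) (hC : Summit.NavierStokesRegularity.NavierStokesRegularity.Theses.RootDecompFactorLadder.ClosedBadSpeeds)
    (hP : Summit.NavierStokesRegularity.NavierStokesRegularity.Theses.RootDecompFactorLadder.SpeedPersistence) :
    ∀ (C α : ℝ) (U : EuclideanSpace ℝ (Fin 3) → EuclideanSpace ℝ (Fin 3)) (p : ℝ → EuclideanSpace ℝ (Fin 3) → ℝ),
      IsClassicalNSSolutionOn (Set.Iio 0) 1 0 (pvAnsatz α (fun y _ => U y)) p →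
      HasTypeIDecay C (pvAnsatz α (fun y _ => U y)) → U = 0 := by
  obtain ⟨Cs, hCs⟩ := hE
  have hbad : ∀ C : ℝ, {α : ℝ | ∃ (U : EuclideanSpace ℝ (Fin 3) → EuclideanSpace ℝ (Fin 3)) (p : ℝ → EuclideanSpace ℝ (Fin 3) → ℝ), (Literature.Analysis.FluidPDE.IsClassicalNSSolutionOn (Set.Iio 0) 1 0 (Literature.Analysis.FluidPDE.pvAnsatz α (fun y _ => U y)) p ∧ Literature.Analysis.FluidPDE.HasTypeIDecay C (Literature.Analysis.FluidPDE.pvAnsatz α (fun y _ => U y))) ∧ U ≠ 0} = ∅ :=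
    fold_or_flee (fun C => {α : ℝ | ∃ (U : EuclideanSpace ℝ (Fin 3) → EuclideanSpace ℝ (Fin 3)) (p : ℝ → EuclideanSpace ℝ (Fin 3) → ℝ), (Literature.Analysis.FluidPDE.IsClassicalNSSolutionOn (Set.Iio 0) 1 0 (Literature.Analysis.FluidPDE.pvAnsatz α (fun y _ => U y)) p ∧ Literature.Analysis.FluidPDE.HasTypeIDecay C (Literature.Analysis.FluidPDE.pvAnsatz α (fun y _ => U y))) ∧ U ≠ 0})
      ⟨Cs, fun C α ⟨U, p, hm, hU⟩ => ⟨U, p, ⟨hm.1, hCs C α U p hm.1 hm.2⟩, hU⟩⟩ hC hP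
      fun C => ⟨0, zero_not_mem_bad C⟩
  intro C α U p hcl hI
  by_contra hU
  have hα : α ∈ {α : ℝ | ∃ (U : EuclideanSpace ℝ (Fin 3) → EuclideanSpace ℝ (Fin 3)) (p : ℝ → EuclideanSpace ℝ (Fin 3) → ℝ), (Literature.Analysis.FluidPDE.IsClassicalNSSolutionOn (Set.Iio 0) 1 0 (Literature.Analysis.FluidPDE.pvAnsatz α (fun y _ => U y)) p ∧ Literature.Analysis.FluidPDE.HasTypeIDecay C (Literature.Analysis.FluidPDE.pvAnsatz α (fun y _ => U y))) ∧ U ≠ 0} := ⟨U, p, ⟨hcl, hI⟩, hU⟩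
  rw [hbad C] at hα
  exact hα

/-- **THE GLUE ITEM `AccumulatingFactorLiouville_of_pieces` HOLDS**: Σ → E → C → P → A (Σ turns RSS Liouville — speed
language — into A — factor language). -/
theorem accumulatingFactorLiouville_of_pieces_proof : Summit.NavierStokesRegularity.NavierStokesRegularity.Theses.RootDecompFactorLadder.AccumulatingFactorLiouville_of_pieces := by
  intro hS hE hC hP u hm hme hd hacc
  rcases hS u hm hme hd hacc with h | ⟨_, C, α, U, p, hU, hcl, hI, _⟩
  · exact h
  · exact absurd (rssLiouville_of_pieces hE hC hP C α U p hcl hI) hU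

/-! ## §4 EXACTNESS: A ⟹ each piece, so A ⟺ Σ ∧ E ∧ C ∧ P — no piece exceeds the door -/

/-- A ⟹ RSS Liouville: a classical Type-I RSS field is an ancient mild member of A's class (KNSS mild gauge),
continuous slices, factor set ALL of `(1, ∞)` (`isRotatedDSS_pvAnsatz`). -/
theorem rssLiouville_of_A (hA : Summit.NavierStokesRegularity.NavierStokesRegularity.Theses.RootDecompFactorLadder.AccumulatingFactorLiouville) :
    ∀ (C α : ℝ) (U : EuclideanSpace ℝ (Fin 3) → EuclideanSpace ℝ (Fin 3)) (p : ℝ → EuclideanSpace ℝ (Fin 3) → ℝ),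
      IsClassicalNSSolutionOn (Set.Iio 0) 1 0 (pvAnsatz α (fun y _ => U y)) p →
      HasTypeIDecay C (pvAnsatz α (fun y _ => U y)) → U = 0 := by
  intro C α U p hcl hI
  have hmild : IsAncientMildSolution 1 (pvAnsatz α (fun y _ => U y)) :=
    Theorems.PolyhedralDssProfileExists.Birth.stub_ancientMild_of_classical_typeI _ p C hcl hI
  have hme : ∀ t : ℝ, t < 0 → AEStronglyMeasurable (pvAnsatz α (fun y _ => U y) t) volume :=
    fun t ht => (hcl.contDiff_velocity (Set.mem_Iio.mpr ht)).continuous.aestronglyMeasurable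
  have hacc : ∀ ε : ℝ, 0 < ε → ∃ (c : ℝ) (R : EuclideanSpace ℝ (Fin 3) ≃ₗᵢ[ℝ] EuclideanSpace ℝ (Fin 3)),
      1 < c ∧ c < 1 + ε ∧ IsRotatedDSS c R (pvAnsatz α (fun y _ => U y)) :=
    fun ε hε => ⟨1 + ε / 2, rotZLIE (-(α * (2 * Real.log (1 + ε / 2)))), by linarith, by linarith,
      PineauVicol2026.isRotatedDSS_pvAnsatz (by linarith) fun _ _ => rfl⟩
  have hae := hA _ hmild hme ⟨C, hI⟩ hacc (-1) (by norm_num)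
  rw [pvAnsatz_profile_neg_one] at hae
  exact (Continuous.ae_eq_iff_eq volume (rss_contDiff hcl).continuous continuous_const).1 hae

/-- **EXACTNESS OF THE SPLIT**: A ⟺ Σ ∧ E ∧ C ∧ P. -/
theorem accumulatingFactorLiouville_iff_pieces :
    Summit.NavierStokesRegularity.NavierStokesRegularity.Theses.RootDecompFactorLadder.AccumulatingFactorLiouville ↔
      Summit.NavierStokesRegularity.NavierStokesRegularity.Theses.RootDecompFactorLadder.SpinStructure ∧ Summit.NavierStokesRegularity.NavierStokesRegularity.Theses.RootDecompFactorLadder.UniformEnvelope ∧ Summit.NavierStokesRegularity.NavierStokesRegularity.Theses.RootDecompFactorLadder.ClosedBadSpeeds ∧ Summit.NavierStokesRegularity.NavierStokesRegularity.Theses.RootDecompFactorLadder.SpeedPersistence := by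
  refine ⟨fun hA => ⟨fun u hm hme hd hacc => Or.inl (hA u hm hme hd hacc), ?_, ?_, ?_⟩,
    fun h => accumulatingFactorLiouville_of_pieces_proof h.1 h.2.1 h.2.2.1 h.2.2.2⟩
  · refine ⟨0, fun C α U p hcl hI t ht x => ?_⟩
    have hU : U = 0 := rssLiouville_of_A hA C α U p hcl hI
    subst hU
    have hz : pvAnsatz α (fun (y : EuclideanSpace ℝ (Fin 3)) (_ : ℝ) => (0 : EuclideanSpace ℝ (Fin 3) → EuclideanSpace ℝ (Fin 3)) y) t x = 0 := by
      simp only [pvAnsatz, Pi.zero_apply]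
      rw [← rotZL_apply, map_zero, smul_zero]
    rw [hz, norm_zero, zero_div]
  · intro C
    have h : {α : ℝ | ∃ (U : EuclideanSpace ℝ (Fin 3) → EuclideanSpace ℝ (Fin 3)) (p : ℝ → EuclideanSpace ℝ (Fin 3) → ℝ), (Literature.Analysis.FluidPDE.IsClassicalNSSolutionOn (Set.Iio 0) 1 0 (Literature.Analysis.FluidPDE.pvAnsatz α (fun y _ => U y)) p ∧ Literature.Analysis.FluidPDE.HasTypeIDecay C (Literature.Analysis.FluidPDE.pvAnsatz α (fun y _ => U y))) ∧ U ≠ 0} = ∅ :=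
      eq_empty_of_subset_empty fun α ⟨U, p, hm, hU⟩ => (hU (rssLiouville_of_A hA C α U p hm.1 hm.2)).elim
    rw [h]
    exact isClosed_empty
  · intro C C' _ α ⟨U, p, hm, hU⟩
    exact absurd (rssLiouville_of_A hA C α U p hm.1 hm.2) hU

/-! ## §5 FIRST RUNGS (bc5): below the Chae–Wolf smallness floor every level is empty, so C, P (and E read at
the floor) are DECIDED there by a tree theorem — a regime of the pieces themselves, not of the summit -/

/-- **Small envelopes carry no bad speed** (any α): a Type-I RSS member with envelope `C ≤ ε₀`
(`ChaeWolf.exists_eps_typeI_small_eq_zero`) is trivial. -/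
theorem exists_floor_bad_eq_empty : ∃ ε₀ : ℝ, 0 < ε₀ ∧ ∀ C : ℝ, C ≤ ε₀ → {α : ℝ | ∃ (U : EuclideanSpace ℝ (Fin 3) → EuclideanSpace ℝ (Fin 3)) (p : ℝ → EuclideanSpace ℝ (Fin 3) → ℝ), (Literature.Analysis.FluidPDE.IsClassicalNSSolutionOn (Set.Iio 0) 1 0 (Literature.Analysis.FluidPDE.pvAnsatz α (fun y _ => U y)) p ∧ Literature.Analysis.FluidPDE.HasTypeIDecay C (Literature.Analysis.FluidPDE.pvAnsatz α (fun y _ => U y))) ∧ U ≠ 0} = ∅ := by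
  obtain ⟨ε₀, hε₀, hA⟩ := ChaeWolf.exists_eps_typeI_small_eq_zero
  refine ⟨ε₀, hε₀, fun C hC => eq_empty_of_subset_empty ?_⟩
  rintro α ⟨U, p, hm, hU⟩
  refine (hU ?_).elim
  rcases le_or_gt C 0 with hC0 | hC0
  · exact rss_eq_zero_of_nonpos hm.2 hC0
  · have hsmall : ∀ t < 0, ∀ x : EuclideanSpace ℝ (Fin 3), Real.sqrt (-t) * ‖pvAnsatz α (fun y _ => U y) t x‖ ≤ ε₀ := by
      intro t ht x
      have hs : 0 < Real.sqrt (-t) := Real.sqrt_pos.2 (by linarith)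
      have hd : 0 < ‖x‖ + Real.sqrt (-t) := by positivity
      calc Real.sqrt (-t) * ‖pvAnsatz α (fun y _ => U y) t x‖
          ≤ Real.sqrt (-t) * (C / (‖x‖ + Real.sqrt (-t))) := mul_le_mul_of_nonneg_left (hm.2 t ht x) hs.le
        _ = C * (Real.sqrt (-t) / (‖x‖ + Real.sqrt (-t))) := by ring
        _ ≤ C * 1 := mul_le_mul_of_nonneg_left ((div_le_one hd).2 (by linarith [norm_nonneg x])) hC0.le
        _ ≤ ε₀ := by linarith
    have hz := hA hC0.le hm.1 hm.2 hsmall (-1) (by norm_num)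
    funext x
    have hx := hz x
    rw [pvAnsatz_neg_one] at hx
    exact hx

/-- **bc5 rung for P** (`SpeedPersistence`): persistence is DECIDED from every level below the floor. -/
theorem speedPersistence_rung : ∃ ε₀ : ℝ, 0 < ε₀ ∧ ∀ C C' : ℝ, C ≤ ε₀ → C < C' →
    {α : ℝ | ∃ (U : EuclideanSpace ℝ (Fin 3) → EuclideanSpace ℝ (Fin 3)) (p : ℝ → EuclideanSpace ℝ (Fin 3) → ℝ), (Literature.Analysis.FluidPDE.IsClassicalNSSolutionOn (Set.Iio 0) 1 0 (Literature.Analysis.FluidPDE.pvAnsatz α (fun y _ => U y)) p ∧ Literature.Analysis.FluidPDE.HasTypeIDecay C (Literature.Analysis.FluidPDE.pvAnsatz α (fun y _ => U y))) ∧ U ≠ 0} ⊆ interior {α : ℝ | ∃ (U : EuclideanSpace ℝ (Fin 3) → EuclideanSpace ℝ (Fin 3)) (p : ℝ → EuclideanSpace ℝ (Fin 3) → ℝ), (Literature.Analysis.FluidPDE.IsClassicalNSSolutionOn (Set.Iio 0) 1 0 (Literature.Analysis.FluidPDE.pvAnsatz α (fun y _ => U y)) p ∧ Literature.Analysis.FluidPDE.HasTypeIDecay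 C' (Literature.Analysis.FluidPDE.pvAnsatz α (fun y _ => U y))) ∧ U ≠ 0} := by
  obtain ⟨ε₀, hε₀, h⟩ := exists_floor_bad_eq_empty
  exact ⟨ε₀, hε₀, fun C C' hC _ => by rw [h C hC]; exact empty_subset _⟩

/-- **bc5 rung for C** (`ClosedBadSpeeds`): closedness is DECIDED below the floor. -/
theorem closedBadSpeeds_rung : ∃ ε₀ : ℝ, 0 < ε₀ ∧ ∀ C : ℝ, C ≤ ε₀ → IsClosed {α : ℝ | ∃ (U : EuclideanSpace ℝ (Fin 3) → EuclideanSpace ℝ (Fin 3)) (p : ℝ → EuclideanSpace ℝ (Fin 3) → ℝ), (Literature.Analysis.FluidPDE.IsClassicalNSSolutionOn (Set.Iio 0) 1 0 (Literature.Analysis.FluidPDE.pvAnsatz α (fun y _ => U y)) p ∧ Literature.Analysis.FluidPDE.HasTypeIDecay C (Literature.Analysis.FluidPDE.pvAnsatz α (fun y _ => U y))) ∧ U ≠ 0} := by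
  obtain ⟨ε₀, hε₀, h⟩ := exists_floor_bad_eq_empty
  exact ⟨ε₀, hε₀, fun C hC => by rw [h C hC]; exact isClosed_empty⟩

/-- N26's deciding theorem re-entered through the pieces: K → Σ → E → C → P → B → Clay (A).
(Statement kept — Theorems files are append-only; since route file rev 2 (2026-08-30) `closes` takes
K, REG, A, B^R, so the proof now passes through the landed FAKE-BREATHER certificates
`isolated_iff_wall` (B ↔ W) and `wall_iff_repaired` (W ↔ REG ∧ A ∧ B^R).) -/
theorem closes_via_pieces (hK : Summit.NavierStokesRegularity.NavierStokesRegularity.Theses.RootDecompFactorLadder.ThresholdSaddleConeRest) (hS : Summit.NavierStokesRegularity.NavierStokesRegularity.Theses.RootDecompFactorLadder.SpinStructure)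
    (hE : Summit.NavierStokesRegularity.NavierStokesRegularity.Theses.RootDecompFactorLadder.UniformEnvelope) (hC : Summit.NavierStokesRegularity.NavierStokesRegularity.Theses.RootDecompFactorLadder.ClosedBadSpeeds) (hP : Summit.NavierStokesRegularity.NavierStokesRegularity.Theses.RootDecompFactorLadder.SpeedPersistence)
    (hB : Summit.NavierStokesRegularity.NavierStokesRegularity.Theses.RootDecompFactorLadder.IsolatedFactorLiouville) : _root_.NavierStokesRegularity := by
  obtain ⟨hREG, -, hBR⟩ := RootDecompFactorLadderFakeBreather.wall_iff_repaired.1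
    (RootDecompFactorLadderFakeBreather.isolated_iff_wall.1 hB)
  exact Summit.NavierStokesRegularity.NavierStokesRegularity.Theses.RootDecompFactorLadder.closes hK hREG (accumulatingFactorLiouville_of_pieces_proof hS hE hC hP) hBR

/-- The same re-entry on the rev-2 binders of `closes`: K → REG → Σ → E → C → P → B^R → Clay (A). -/
theorem closes_via_pieces_repaired (hK : Summit.NavierStokesRegularity.NavierStokesRegularity.Theses.RootDecompFactorLadder.ThresholdSaddleConeRest) (hREG : Summit.NavierStokesRegularity.NavierStokesRegularity.Theses.RootDecompFactorLadder.TypeIRdssRepresentative)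
    (hS : Summit.NavierStokesRegularity.NavierStokesRegularity.Theses.RootDecompFactorLadder.SpinStructure) (hE : Summit.NavierStokesRegularity.NavierStokesRegularity.Theses.RootDecompFactorLadder.UniformEnvelope) (hC : Summit.NavierStokesRegularity.NavierStokesRegularity.Theses.RootDecompFactorLadder.ClosedBadSpeeds) (hP : Summit.NavierStokesRegularity.NavierStokesRegularity.Theses.RootDecompFactorLadder.SpeedPersistence)
    (hBR : Summit.NavierStokesRegularity.NavierStokesRegularity.Theses.RootDecompFactorLadder.PastIsolatedFactorLiouville) : _root_.NavierStokesRegularity :=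
  Summit.NavierStokesRegularity.NavierStokesRegularity.Theses.RootDecompFactorLadder.closes hK hREG (accumulatingFactorLiouville_of_pieces_proof hS hE hC hP) hBR

end Summit.NavierStokesRegularity.NavierStokesRegularity.Theorems.RootDecompFactorLadderFoldOrFlee
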